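import Literature.MathematicalPhysics.QuantumFieldTheory.Balaban1983to89.B9Thm31SiteGradGpDivDecayReg335Y
import Literature.MathematicalPhysics.QuantumFieldTheory.Balaban1983to89.B9Thm31SiteAgmonExponentY
import Literature.MathematicalPhysics.QuantumFieldTheory.Balaban1983to89.Node00.OpsYNablaBridge

/-!
# `Balaban1983to89.B9Eq346GradGpDivTorusL2` — T. Bałaban, *Propagators for lattice gauge theories in a background field*, Commun. Math. Phys. **99**
# (1985) 389–434 [Balaban1985BackgroundPropagators] Thm 3.1 (3.46) p. 398, THE ORDER-ZERO ENTRY `‖h∇_UG′(U)∇*_Uλ‖ ≤ B₀·e^{−δ₀d(y,y′)}‖h‖‖λ‖`, by S. Agmon's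
# method [Agmon1982]: ★★ **THE BLOCK-TO-BLOCK `L²` DECAY OF `D_U G′(U) D*_U` ON THE (3.35) CLASS WITH PRINT'S RATE IN THE BLOCK DISTANCE `d(y,y′)`** —
# dag-n06-w1's `L²`-local estimate `hs_restrict_cdS_GpY_cdsS_le_exp_canonical` at dag-n06-j's multi-scale Agmon exponent SHIFTED BY ONE LATTICE STEP, read for
# def-Y's bond-valued letters `gradY U ∘ GpY (parSymY) U ∘ divY U` on fine-bond functions supported in one torus block

statement-level skeleton of published theorems with citation tags; proofs where landed; nothing here is a claim about the Yang–Mills mass gap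

THE PRINT (p. 398, verbatim).  (3.46): *«‖hG′(U)λ‖, ‖hζ∇_UG′(U)λ‖(Lʲη), ‖hG′(U)∇\*_Uζλ‖(Lʲη), ‖hΔ_UG′(U)λ‖, ‖h∇_UG′(U)∇\*_Uλ‖, …
≤ B₀(Lʲη)(Lʲ′η)e^{−δ₀d(y,y′)}‖h‖‖λ‖ for supp h ⊂ Δ̃(y), y ∈ Λ_j, supp λ ⊂ Δ̃(y′)»*, prefactor list `[(Lʲη)², Lʲη, Lʲη, 1, 1, 1]`; (3.47):
*«|∇_UG′(U)∇\*_Uλ|_{(γ)} ≤ B₀|λ|_{(γ)}»* — the entry `∇_UG′∇\*_U` carries NO scale factor (an operator of order zero); (3.3) p. 390–391 (`(D_Uλ)(⟨x, x+ηe_μ⟩) =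
(D_{U,μ}λ)(x)`), (3.8) p. 392 (`D\*_U` the adjoint); p. 397: *«we will use the weighted distance d(y,y′) defined by (2.36) in [4]»* ([B6] (2.46) p. 231).

WHY THIS FILE (cell context; WIDTH-209 N06 piece 4 = W-e «`hstepL2` in block-L²», the located INPUT HAND of dag-n06-w8's road, agreed on the pub-ymgap bus
2026-08-28).  dag-n06-w8's Schur road derives the block-`L²` bound of the perturbation step `Δ′_π` (the certificate's `hstepL2`, `B9Thm312WholeL2.StepL2`) from the
DISPLAYED sup schemas `Thm31GpMaj ∕ Proj349Maj ∕ CurrentMaj` plus ONE genuinely-`L²` input: the order-zero line (3.46)₄ for the SITE propagator `G′(U)` between the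
gauge-sector derivatives `D_U`, `D\*_U` — (3.42) has no sup line for `∇G′∇\*` ((3.44) is Hölder).  dag-n06-w1 PROVED that line at def-Y's letters by Agmon's method
(`B9Thm31SiteGradGpDivDecayReg335Y.hs_restrict_cdS_GpY_cdsS_le_exp_canonical`: for an admissible exponent `ρ` vanishing on a set `B ⊇ supp ∇\*_{U,μ}λ` and `≥ r` on `A`,
`Σ_{z∈A}Σ_ν HS((∇_{U,ν}G′(U)∇\*_{U,μ}λ)(z)) ≤ 10·‖λ‖²₁∕(e^{δ₀r})²`, `δ₀ = 1∕(4(d+2))`), and dag-n06-j supplied the member-uniform multi-scale exponent `ρ_s = msRhoT`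
dominating print's block distance (`B9Thm31SiteAgmonExponentY.msRhoY_*`).  THIS FILE instantiates one at the other:
* §1 THE SHIFTED EXPONENT `ρ⁺_s := max (ρ_s − 1) 0` — the source of (3.46)₄ is `∇\*_{U,μ}λ`, supported ONE LATTICE STEP beyond `supp λ ⊂ Δ(s)`, where `ρ_s ≤ 1`
  (one bond cap); `ρ⁺_s` vanishes there and keeps the four Agmon binders: `msRhoYPos_bond ∕ _bond' ∕ _block ∕ _eq_zero ∕ _eq_zero_shift ∕ _ge ∕ _ge_of_le`.
* §2 ★ `hs_restrict_cdS_GpY_cdsS_le_distT` — dag-n06-w1's canonical estimate at `ρ⁺_s`: for `λ` supported in the block `s` and `A` in blocks at block distance `≥ n`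
  from `s`, `Σ_{z∈A}Σ_ν HS((∇_{U,ν}G′(U)∇\*_{U,μ}λ)(z)) ≤ 10·‖λ‖²₁ ∕ (e^{δ₀((n−1)∕(2L) − 1)})²`.
* §3 ★★ `hs_block_gradY_GpY_divY_le` — THE BOND-LETTER FORM: for `A : bonds → M_N(ℂ)` supported on the fine bonds of the torus block `s` and every block `t`,
  `Σ_{f ∈ Δ(t)} HS((D_U G′(U) D\*_U A)(f)) ≤ c_f⁴·10(d+1)·(e^{δ₀((d_T(t,s)−1)∕(2L) − 1)})⁻²·Σ_f HS(A(f))` — def-Y's `gradY U ∘ GpY (parSymY) U ∘ divY U` through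
  `Node00.OpsYNablaBridge.gradY_apply_eq_cdS ∕ divY_apply_eq_sum_cdsS` (`D_U = c_f·∇_U`, `D\*_UA = c_f·Σ_μ∇\*_{U,μ}A_μ`) and Cauchy–Schwarz over the `d+1` components.
CONSTANTS (numbers).  `10·(d+1)·c_f⁴`, `c_f = L^k` (def-Y's physical units of `D_U`, `D\*_U`; the knit's site letter `GcoS` carries `η² = c_f⁻²` and cancels them —
the sequel `B9Eq346GradGpDivAtPinsL2`); rate `δ₀∕(2L)` per unit of `d_T` with the additive loss `1 + 2L` lattice-steps' worth (`e^{δ₀(1 + 1∕(2L))}`).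
HONEST SCOPE.  One instantiation on top of landed files + finite sums; the ANALYTIC input is dag-n06-w1's theorem (proved, hypothesis-free on the class); nothing of
[B9] beyond it is asserted; the sup-norm (3.47), (3.42)–(3.45), (3.49), (3.117) untouched; count-neutral; N06 NOT discharged; K1⁷ NOT closed; one finite lattice at a
time — nothing continuum ∕ OS ∕ mass gap ∕ Clay.  Cell `pub-ymgap` (HUMAN RULING D-0062 ∕ D-0154), Track A node N06 [B9], width seat `pub-ymgap-dag-n06-w7` (g0),
2026-08-28.  NEW file; imports three BUILT modules; nothing landed is modified.  Net new unproved facts: 0.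
-/

noncomputable section

namespace Literature.MathematicalPhysics.QuantumFieldTheory.Balaban1983to89.B9Eq346GradGpDivTorusL2

open Literature.MathematicalPhysics.QuantumFieldTheory.Balaban1983to89
open Node00 B6KLevelCensusIndexV1 B6Geom246MultiLevelBox B6MultiLevelBoxOperator B6MultiLevelTorusOperator B6GlobalChartV1 B9BackgroundsKLevelV1
  B9Eq39Adjoint B9Thm311ReadingCoords B9Thm31SiteGradGpDivDecayReg335Y B9Thm31SiteAgmonExponentY B6Geom246MultiLevelTorus B6AgmonExponentMultiLevelTorus
open Literature.MathematicalPhysics.QuantumFieldTheory.Balaban1983to89.B9Ineq369CurvatureSmallAtLettersY (hs_nonneg hs_smul trIP_one_self_eq)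
open Literature.MathematicalPhysics.QuantumFieldTheory.Balaban1983to89.B9Ineq349SiteComposite (cdSL cdsSL cdSL_apply cdsSL_apply)
open Literature.MathematicalPhysics.QuantumFieldTheory.Balaban1983to89.Node00.OpsYNablaBridge (chartY bondCompY bondCompY_apply gradY_apply_eq_cdS
  divY_eq_sum_cdsSL_comp sum_bond_eq cdS_apply cdsS_apply shiftY_chartY)
open scoped Matrix Matrix.Norms.L2Operator

variable {d ℓ : ℕ} {hd : 1 ≤ d + 1} {hL : Odd (ℓ + 1) ∧ 1 < ℓ + 1} {b₀ b₁ : ℝ}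
variable (i : KIdx d ℓ hd hL b₀ b₁) {N : ℕ} {G : Subgroup (Matrix (Fin N) (Fin N) ℂ)ˣ}

/-! ## §1 The shifted multi-scale exponent `ρ⁺_s = max (ρ_s − 1) 0` and its Agmon binders -/

section Exponent

/-- the first bond cap of `ρ⁺_s` (dag-n06-w1's binder `hρ1`): `|ρ⁺_s(z + e_μ) − ρ⁺_s z| ≤ (L^{lev z})⁻¹` — `t ↦ max (t − 1) 0` is `1`-Lipschitz.
[cite: Balaban1985BackgroundPropagators, p.397 (weighted distance); Agmon1982, Ch.1] -/
theorem msRhoYPos_bond (s : BlkY i) (μ : Fin (d + 1)) (z : SiteY i) :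
    |max (msRhoT i.D s (shiftY i μ z) - 1) 0 - max (msRhoT i.D s z - 1) 0| ≤ ((((ℓ + 1) ^ (blkOf i.D.toDomains z).1.1 : ℕ) : ℝ))⁻¹ := by
  refine (abs_max_sub_max_le_abs _ _ _).trans ?_
  rw [sub_sub_sub_cancel_right]
  exact msRhoY_bond i s μ z

/-- the second bond cap of `ρ⁺_s` (binder `hρ2`): `|ρ⁺_s(z + e_μ) − ρ⁺_s z| ≤ (L^{lev(z + e_μ)})⁻¹`. [cite: Balaban1985BackgroundPropagators, p.397; Agmon1982, Ch.1] -/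
theorem msRhoYPos_bond' (s : BlkY i) (μ : Fin (d + 1)) (z : SiteY i) :
    |max (msRhoT i.D s (shiftY i μ z) - 1) 0 - max (msRhoT i.D s z - 1) 0| ≤ ((((ℓ + 1) ^ (blkOf i.D.toDomains (shiftY i μ z)).1.1 : ℕ) : ℝ))⁻¹ := by
  refine (abs_max_sub_max_le_abs _ _ _).trans ?_
  rw [sub_sub_sub_cancel_right]
  exact msRhoY_bond' i s μ z

/-- the block oscillation of `ρ⁺_s` (binder `hρD`). [cite: Balaban1984PropagatorsII, (2.3)–(2.4) p.224; Agmon1982, Ch.1] -/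
theorem msRhoYPos_block (s : BlkY i) (z w : SiteY i) (h : blkOf i.D.toDomains w = blkOf i.D.toDomains z) :
    |max (msRhoT i.D s z - 1) 0 - max (msRhoT i.D s w - 1) 0| ≤ (d : ℝ) + 1 := by
  refine (abs_max_sub_max_le_abs _ _ _).trans ?_
  rw [sub_sub_sub_cancel_right]
  exact msRhoY_block i s z w h

/-- `ρ⁺_s` vanishes on the source block. [cite: Balaban1985BackgroundPropagators, (3.46) p.398 (supp λ ⊂ Δ̃(y′)); Agmon1982, Ch.1] -/
theorem msRhoYPos_eq_zero {s : BlkY i} {z : SiteY i} (hz : blkOf i.D.toDomains z = s) : max (msRhoT i.D s z - 1) 0 = 0 := by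
  rw [msRhoY_eq_zero i hz]; norm_num

/-- ★ `ρ⁺_s` vanishes ONE LATTICE STEP off the source block too (the support of `∇\*_{U,μ}λ`): `ρ_s(w + e_μ) ≤ ρ_s(w) + (L^{lev w})⁻¹ ≤ 1` for `w ∈ Δ(s)`.
[cite: Balaban1985BackgroundPropagators, (3.46) p.398 (supp λ ⊂ Δ̃(y′)), (3.8) p.392; Agmon1982, Ch.1] -/
theorem msRhoYPos_eq_zero_shift {s : BlkY i} (μ : Fin (d + 1)) {w : SiteY i} (hw : blkOf i.D.toDomains w = s) :
    max (msRhoT i.D s (shiftY i μ w) - 1) 0 = 0 := by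
  have h1 := msRhoY_bond i s μ w
  rw [msRhoY_eq_zero i hw, sub_zero] at h1
  have hpow : (1 : ℝ) ≤ (((ℓ + 1) ^ (blkOf i.D.toDomains w).1.1 : ℕ) : ℝ) := by exact_mod_cast Nat.one_le_pow _ _ (Nat.succ_pos ℓ)
  have h2 : msRhoT i.D s (shiftY i μ w) ≤ 1 := ((le_abs_self _).trans h1).trans (inv_le_one_of_one_le₀ hpow)
  exact max_eq_right (by linarith)

/-- ★ DOMINATION: `(d_T(y(z), s) − 1)∕(2L) − 1 ≤ ρ⁺_s(z)`. [cite: Balaban1984PropagatorsII, (2.46) p.231; Balaban1985BackgroundPropagators, p.397; Agmon1982, Ch.1] -/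
theorem msRhoYPos_ge (s : BlkY i) (z : SiteY i) :
    (((bondT i.D).dist (blkOf i.D.toDomains z) s : ℝ) - 1) / (2 * ((ℓ + 1 : ℕ) : ℝ)) - 1 ≤ max (msRhoT i.D s z - 1) 0 :=
  le_trans (sub_le_sub_right (msRhoY_ge i s z) 1) (le_max_left _ _)

/-- the `hr` binder for a set of sites in blocks at block distance `≥ n` from the source block: `(n − 1)∕(2L) − 1 ≤ ρ⁺_s` there.
[cite: Balaban1984PropagatorsII, (2.46) p.231; Balaban1985BackgroundPropagators, (3.46) p.398] -/
theorem msRhoYPos_ge_of_le (s : BlkY i) {n : ℕ} {A : Finset (SiteY i)} (hA : ∀ z ∈ A, n ≤ (bondT i.D).dist (blkOf i.D.toDomains z) s) :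
    ∀ z ∈ A, (((n : ℝ)) - 1) / (2 * ((ℓ + 1 : ℕ) : ℝ)) - 1 ≤ max (msRhoT i.D s z - 1) 0 := fun z hz =>
  le_trans (sub_le_sub_right (msRhoY_ge_of_le i s hA z hz) 1) (le_max_left _ _)

end Exponent

/-! ## §2 (3.46)₄ in the direction letters, with print's rate in the block distance -/

section Site

/-- ★ **dag-n06-w1's (3.46)₄ AT THE SHIFTED MULTI-SCALE EXPONENT**: `G ≤ U(N)`, `N ≥ 1`, `0 ≤ c·M·α₀`, `c·M·α₀·(d+1) ≤ 1∕16`, `U ∈ Reg335 c α₀`; a source block `s`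
carrying `λ`, a finite set `A` of sites in blocks at block distance `≥ n` from `s`.  THEN, for every direction `μ`,
`Σ_{z∈A}Σ_ν HS((∇_{U,ν}G′(U)∇\*_{U,μ}λ)(z)) ≤ 10·‖λ‖²₁ ∕ (e^{δ₀((n−1)∕(2L) − 1)})²`, `δ₀ = 1∕(4(d+2))` — member-uniform.
[cite: Balaban1985BackgroundPropagators, Thm 3.1 (3.46)–(3.47) p.398, (3.35) p.396, p.397 (weighted distance); Balaban1984PropagatorsII, (2.46) p.231; Agmon1982, Ch.1, Thm 1.5] -/
theorem hs_restrict_cdS_GpY_cdsS_le_distT [Nonempty (Fin N)] (hG : G ≤ B7Prop2Explicit.unitaryUnits (Matrix (Fin N) (Fin N) ℂ))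
    {U : CfgY (Matrix (Fin N) (Fin N) ℂ) i} {c α₀ : ℝ} (hC0 : 0 ≤ c * (kGeo i).M * α₀) (hC1 : c * (kGeo i).M * α₀ * ((d : ℝ) + 1) ≤ 1 / 16)
    (hreg : (bg9K (Matrix (Fin N) (Fin N) ℂ) G i).Reg335 c α₀ U) (μ : Fin (d + 1)) (s : BlkY i)
    {A : Finset (SiteY i)} {Λ : SiteY i → Matrix (Fin N) (Fin N) ℂ} (hΛ : ∀ z, blkOf i.D.toDomains z ≠ s → Λ z = 0)
    {n : ℕ} (hA : ∀ z ∈ A, n ≤ (bondT i.D).dist (blkOf i.D.toDomains z) s) :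
    ∑ z ∈ A, ∑ ν : Fin (d + 1), ∑ a, ∑ b, ‖cdS i U ν (GpY i (parSymY i) U (cdsS i U μ Λ)) z a b‖ ^ 2
      ≤ 10 * trIP (fun _ => (1 : ℝ)) Λ Λ / Real.exp ((1 / (4 * ((d : ℝ) + 2))) * (((((n : ℝ)) - 1) / (2 * ((ℓ + 1 : ℕ) : ℝ)) - 1))) ^ 2 := by
  classical
  -- the source `∇*_{U,μ}λ` lives on `Δ(s)` and its `e_μ`-shift
  set B : Finset (SiteY i) := Finset.univ.filter (fun z => blkOf i.D.toDomains z = s ∨ blkOf i.D.toDomains ((shiftY i μ).symm z) = s) with hB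
  have hv : ∀ z, z ∉ B → cdsS i U μ Λ z = 0 := by
    intro z hz
    rw [hB, Finset.mem_filter, not_and] at hz
    have hz' := hz (Finset.mem_univ z)
    rw [not_or] at hz'
    rw [cdsS_apply, hΛ _ hz'.2, hΛ _ hz'.1, R_zero, sub_zero]
  have hρB : ∀ z ∈ B, max (msRhoT i.D s z - 1) 0 = 0 := by
    intro z hz
    rw [hB, Finset.mem_filter] at hz
    rcases hz.2 with h | h
    · exact msRhoYPos_eq_zero i h
    · have e : z = shiftY i μ ((shiftY i μ).symm z) := ((shiftY i μ).apply_symm_apply z).symm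
      rw [e]
      exact msRhoYPos_eq_zero_shift i μ h
  exact hs_restrict_cdS_GpY_cdsS_le_exp_canonical i hG hC0 hC1 hreg (ρ := fun z => max (msRhoT i.D s z - 1) 0) (msRhoYPos_bond i s) (msRhoYPos_bond' i s)
    (msRhoYPos_block i s) μ hv hρB (msRhoYPos_ge_of_le i s hA)

end Site

/-! ## §3 The bond-letter form: `D_U G′(U) D*_U` between torus blocks of fine bonds -/

section Bond

/-- Cauchy–Schwarz over the components: `HS(Σ_μ M_μ) ≤ (d+1)·Σ_μ HS(M_μ)`. [cite: Balaban1985BackgroundPropagators, (3.8) p.392 (the sum over μ), bookkeeping] -/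
theorem hs_sum_fin_le (M : Fin (d + 1) → Matrix (Fin N) (Fin N) ℂ) :
    ∑ a, ∑ b, ‖(∑ μ, M μ) a b‖ ^ 2 ≤ ((d : ℝ) + 1) * ∑ μ, ∑ a, ∑ b, ‖M μ a b‖ ^ 2 := by
  have hcomm : ∑ μ : Fin (d + 1), ∑ a, ∑ b, ‖M μ a b‖ ^ 2 = ∑ a, ∑ b, ∑ μ : Fin (d + 1), ‖M μ a b‖ ^ 2 := by
    rw [Finset.sum_comm]
    exact Finset.sum_congr rfl fun a _ => Finset.sum_comm
  rw [hcomm, Finset.mul_sum]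
  refine Finset.sum_le_sum fun a _ => ?_
  rw [Finset.mul_sum]
  refine Finset.sum_le_sum fun b _ => ?_
  rw [Matrix.sum_apply]
  have hcard : ((Finset.univ : Finset (Fin (d + 1))).card : ℝ) = (d : ℝ) + 1 := by
    rw [Finset.card_univ, Fintype.card_fin]; push_cast; ring
  calc ‖∑ μ, M μ a b‖ ^ 2 ≤ (∑ μ, ‖M μ a b‖) ^ 2 := pow_le_pow_left₀ (norm_nonneg _) (norm_sum_le _ _) 2
    _ ≤ (Finset.univ : Finset (Fin (d + 1))).card * ∑ μ, ‖M μ a b‖ ^ 2 := sq_sum_le_card_mul_sum_sq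
    _ = ((d : ℝ) + 1) * ∑ μ, ‖M μ a b‖ ^ 2 := by rw [hcard]

/-- the torus block of a fine bond is the block of its (charted) initial point. [cite: Balaban1984PropagatorsII, (2.45) p.231, bookkeeping] -/
theorem blkV1_eq_blkOf_chartY (f : FBondY i) : blkV1 i.hN i.D f = blkOf i.D.toDomains (chartY i f.src) := rfl

/-- the same for the bond `⟨chart⁻¹ z, μ⟩`. [cite: Balaban1984PropagatorsII, (2.45) p.231, bookkeeping] -/
theorem blkV1_mk_chartY_symm (z : SiteY i) (μ : Fin (d + 1)) :
    blkV1 i.hN i.D (⟨(chartY i).symm z, μ⟩ : FBondY i) = blkOf i.D.toDomains z := by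
  rw [blkV1_eq_blkOf_chartY, Equiv.apply_symm_apply]

/-- ★ the letter `D_U G′(U) D\*_U` evaluated at a bond: `(D_UG′D\*_UA)(⟨x, ν⟩) = c_f² · Σ_μ (∇_{U,ν}G′(U)∇\*_{U,μ}A_μ)(chart x)`.
[cite: Balaban1985BackgroundPropagators, (3.3) p.390–391, (3.8) p.392, (3.46) p.398] -/
theorem gradY_GpY_divY_apply (U : CfgY (Matrix (Fin N) (Fin N) ℂ) i) (A : FBondY i → Matrix (Fin N) (Fin N) ℂ) (f : FBondY i) :
    (gradY i U ∘ₗ GpY i (parSymY i) U ∘ₗ divY i U) A f =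
      (((i.cf ^ 2 : ℝ)) : ℂ) • ∑ μ : Fin (d + 1), cdS i U f.dir (GpY i (parSymY i) U (cdsS i U μ (bondCompY i μ A))) (chartY i f.src) := by
  rw [LinearMap.comp_apply, LinearMap.comp_apply, gradY_apply_eq_cdS, divY_eq_sum_cdsSL_comp]
  rw [LinearMap.smul_apply, map_smul, ← cdSL_apply, map_smul, LinearMap.coe_sum, Finset.sum_apply, map_sum, map_sum]
  rw [Pi.smul_apply, Finset.sum_apply, smul_smul, ← Complex.ofReal_mul, ← pow_two]
  congr 1

/-- ★★ **(3.46)₄ FOR THE BOND LETTER `D_U G′(U) D\*_U` BETWEEN TORUS BLOCKS**: `G ≤ U(N)`, `N ≥ 1`, `0 ≤ c·M·α₀`, `c·M·α₀·(d+1) ≤ 1∕16`, `U ∈ Reg335 c α₀`; for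
`A : bonds → M_N(ℂ)` vanishing off the fine bonds of the block `s` and every block `t`,
`Σ_{f : y(f) = t} HS((D_UG′(U)D\*_UA)(f)) ≤ c_f⁴·10(d+1)·(e^{δ₀((d_T(t,s)−1)∕(2L) − 1)})⁻²·Σ_f HS(A(f))`, `δ₀ = 1∕(4(d+2))` — print's `B₀·1·e^{−δ₀d(y,y′)}`
shape, member-uniform apart from def-Y's units `c_f⁴` (cancelled by the knit's `η²`-letter in the sequel).
[cite: Balaban1985BackgroundPropagators, Thm 3.1 (3.46)–(3.47) p.398, (3.3) p.390, (3.8) p.392, (3.35) p.396; Balaban1984PropagatorsII, (2.46) p.231, (2.54) p.233; Agmon1982, Ch.1, Thm 1.5] -/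
theorem hs_block_gradY_GpY_divY_le [Nonempty (Fin N)] (hG : G ≤ B7Prop2Explicit.unitaryUnits (Matrix (Fin N) (Fin N) ℂ))
    {U : CfgY (Matrix (Fin N) (Fin N) ℂ) i} {c α₀ : ℝ} (hC0 : 0 ≤ c * (kGeo i).M * α₀) (hC1 : c * (kGeo i).M * α₀ * ((d : ℝ) + 1) ≤ 1 / 16)
    (hreg : (bg9K (Matrix (Fin N) (Fin N) ℂ) G i).Reg335 c α₀ U) (s t : BlkY i)
    {A : FBondY i → Matrix (Fin N) (Fin N) ℂ} (hA : ∀ f, blkV1 i.hN i.D f ≠ s → A f = 0) :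
    ∑ f : FBondY i, (if blkV1 i.hN i.D f = t then (∑ a, ∑ b, ‖(gradY i U ∘ₗ GpY i (parSymY i) U ∘ₗ divY i U) A f a b‖ ^ 2) else 0)
      ≤ i.cf ^ 4 * (10 * ((d : ℝ) + 1))
          / Real.exp ((1 / (4 * ((d : ℝ) + 2))) * (((((bondT i.D).dist t s : ℝ)) - 1) / (2 * ((ℓ + 1 : ℕ) : ℝ)) - 1)) ^ 2
        * ∑ f : FBondY i, ∑ a, ∑ b, ‖A f a b‖ ^ 2 := by
  classical
  set T := gradY i U ∘ₗ GpY i (parSymY i) U ∘ₗ divY i U with hT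
  set E : ℝ := Real.exp ((1 / (4 * ((d : ℝ) + 2))) * (((((bondT i.D).dist t s : ℝ)) - 1) / (2 * ((ℓ + 1 : ℕ) : ℝ)) - 1)) with hE
  have hE0 : 0 < E := Real.exp_pos _
  -- the components `A_μ` live on the block `s`
  have hAμ : ∀ (μ : Fin (d + 1)) (w : SiteY i), blkOf i.D.toDomains w ≠ s → bondCompY i μ A w = 0 := by
    intro μ w hw
    rw [bondCompY_apply]
    exact hA _ (by rw [blkV1_mk_chartY_symm]; exact hw)
  -- §2 per component, on the sites of `t`
  set At : Finset (SiteY i) := Finset.univ.filter (fun z => blkOf i.D.toDomains z = t) with hAt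
  have hAt' : ∀ z ∈ At, (bondT i.D).dist t s ≤ (bondT i.D).dist (blkOf i.D.toDomains z) s := by
    intro z hz
    rw [hAt, Finset.mem_filter] at hz
    rw [hz.2]
  have hcomp : ∀ μ : Fin (d + 1), ∑ z ∈ At, ∑ ν : Fin (d + 1), ∑ a, ∑ b, ‖cdS i U ν (GpY i (parSymY i) U (cdsS i U μ (bondCompY i μ A))) z a b‖ ^ 2
      ≤ 10 * trIP (fun _ => (1 : ℝ)) (bondCompY i μ A) (bondCompY i μ A) / E ^ 2 :=
    fun μ => hs_restrict_cdS_GpY_cdsS_le_distT i hG hC0 hC1 hreg μ s (hAμ μ) hAt'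
  -- the bond sum as a site sum over `t` and the directions
  have hLHS : ∑ f : FBondY i, (if blkV1 i.hN i.D f = t then (∑ a, ∑ b, ‖T A f a b‖ ^ 2) else 0)
      = ∑ z ∈ At, ∑ ν : Fin (d + 1), ∑ a, ∑ b, ‖T A ⟨(chartY i).symm z, ν⟩ a b‖ ^ 2 := by
    rw [sum_bond_eq, ← Equiv.sum_comp (chartY i).symm]
    rw [hAt, Finset.sum_filter]
    refine Finset.sum_congr rfl fun z _ => ?_
    simp only [blkV1_mk_chartY_symm]
    split_ifs with h
    · rfl
    · simp
  -- each bond value: `c_f²·Σ_μ(…)`, HS ≤ c_f⁴(d+1)Σ_μ HS(…)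
  have hval : ∀ (z : SiteY i) (ν : Fin (d + 1)), ∑ a, ∑ b, ‖T A ⟨(chartY i).symm z, ν⟩ a b‖ ^ 2
      ≤ i.cf ^ 4 * (((d : ℝ) + 1) * ∑ μ : Fin (d + 1), ∑ a, ∑ b, ‖cdS i U ν (GpY i (parSymY i) U (cdsS i U μ (bondCompY i μ A))) z a b‖ ^ 2) := by
    intro z ν
    rw [hT, gradY_GpY_divY_apply, hs_smul, Complex.norm_real, Real.norm_eq_abs, sq_abs, Equiv.apply_symm_apply]
    rw [show (i.cf ^ 2) ^ 2 = i.cf ^ 4 by ring]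
    exact mul_le_mul_of_nonneg_left (hs_sum_fin_le _) (by positivity)
  -- the component norms add up to `Σ_f HS(A(f))`
  have hRHS : ∑ μ : Fin (d + 1), trIP (fun _ => (1 : ℝ)) (bondCompY i μ A) (bondCompY i μ A) = ∑ f : FBondY i, ∑ a, ∑ b, ‖A f a b‖ ^ 2 := by
    rw [sum_bond_eq, ← Equiv.sum_comp (chartY i).symm, Finset.sum_comm]
    refine Finset.sum_congr rfl fun μ _ => ?_
    rw [trIP_one_self_eq]
    refine Finset.sum_congr rfl fun z _ => ?_
    rw [bondCompY_apply]
  have hS0 : 0 ≤ ∑ f : FBondY i, ∑ a, ∑ b, ‖A f a b‖ ^ 2 := Finset.sum_nonneg fun f _ => hs_nonneg _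
  rw [hLHS]
  calc ∑ z ∈ At, ∑ ν : Fin (d + 1), ∑ a, ∑ b, ‖T A ⟨(chartY i).symm z, ν⟩ a b‖ ^ 2
      ≤ ∑ z ∈ At, ∑ ν : Fin (d + 1), i.cf ^ 4 * (((d : ℝ) + 1) *
          ∑ μ : Fin (d + 1), ∑ a, ∑ b, ‖cdS i U ν (GpY i (parSymY i) U (cdsS i U μ (bondCompY i μ A))) z a b‖ ^ 2) :=
        Finset.sum_le_sum fun z _ => Finset.sum_le_sum fun ν _ => hval z ν
    _ = i.cf ^ 4 * (((d : ℝ) + 1) * ∑ μ : Fin (d + 1),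
          ∑ z ∈ At, ∑ ν : Fin (d + 1), ∑ a, ∑ b, ‖cdS i U ν (GpY i (parSymY i) U (cdsS i U μ (bondCompY i μ A))) z a b‖ ^ 2) := by
        have hcomm : ∑ μ : Fin (d + 1), ∑ z ∈ At, ∑ ν : Fin (d + 1), ∑ a, ∑ b, ‖cdS i U ν (GpY i (parSymY i) U (cdsS i U μ (bondCompY i μ A))) z a b‖ ^ 2
            = ∑ z ∈ At, ∑ ν : Fin (d + 1), ∑ μ : Fin (d + 1), ∑ a, ∑ b, ‖cdS i U ν (GpY i (parSymY i) U (cdsS i U μ (bondCompY i μ A))) z a b‖ ^ 2 := by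
          rw [Finset.sum_comm]
          exact Finset.sum_congr rfl fun z _ => Finset.sum_comm
        rw [hcomm]
        simp only [Finset.mul_sum]
    _ ≤ i.cf ^ 4 * (((d : ℝ) + 1) * ∑ μ : Fin (d + 1), 10 * trIP (fun _ => (1 : ℝ)) (bondCompY i μ A) (bondCompY i μ A) / E ^ 2) :=
        mul_le_mul_of_nonneg_left (mul_le_mul_of_nonneg_left (Finset.sum_le_sum fun μ _ => hcomp μ) (by positivity)) (by positivity)
    _ = i.cf ^ 4 * (10 * ((d : ℝ) + 1)) / E ^ 2 * ∑ f : FBondY i, ∑ a, ∑ b, ‖A f a b‖ ^ 2 := by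
        rw [← hRHS]
        simp only [Finset.mul_sum]
        exact Finset.sum_congr rfl fun μ _ => by ring

end Bond

end Literature.MathematicalPhysics.QuantumFieldTheory.Balaban1983to89.B9Eq346GradGpDivTorusL2

end
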